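import Summits.Ventures.PercRepro.S1LadderCells

/-!
# PercRepro — THE KILL LEVER: THE DEPENDENT `p`-SETS ARE `Y`-SETS (p2, gen 22; SUBCLAIM-S1 §6.6)

The cell form's `Y`-side (`midCount_ge_K7`) counts the sets of size `5 … p − 1` only. A `p`-set `A` that contains a
circuit `C` is dependent, so `r(A) < p`; unless `r(A) ≤ 4` (then `A` is already in the `R₃ + R₄` budget) it is a
`Y`-set. There are `C(n − |C|, p − |C|)` of them for one circuit; for `m` distinct triangles (which pairwise meet in
at most one point under (C1), so `|T ∪ T'| ≥ 5`) Bonferroni gives `≥ m·C(n − 3, p − 3) − C(m, 2)·C(n − 5, p − 5)`.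

* `two_mul_sum_card_le_two_mul_card_biUnion_add` — Bonferroni's lower bound for a finite union;
* `oversets`, `mem_oversets`, `card_oversets` — the `(|X| + j)`-subsets of `F` through `X`: `C(|F| − |X|, j)` of them;
* `ncard_inter_le_one_of_triangles` — two distinct triangles meet in at most one point (C1);
* **`midCount_ge_K7_kill`** — the `Y`-side bound with the kill of `m` circuits of size `k` (pairwise covering `≥ 5` points);
* `midCount_ge_K7_kill_triangles`, `midCount_ge_K7_kill_four` — the triangles ((C1)) and the four-circuits.
Axioms: standard.
-/

open scoped Matroid

namespace PercRepro

namespace S1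

open Set

variable {α : Type}

/-- **Bonferroni's lower bound for a union**: `2·Σ_i |K i| ≤ 2·|⋃_i K i| + Σ_i Σ_{j ≠ i} |K i ∩ K j|` over a
finset of indices (induction on the index set; `|A ∪ B| + |A ∩ B| = |A| + |B|` and `|A ∩ K x| ≤ Σ_i |K i ∩ K x|`). -/
theorem two_mul_sum_card_le_two_mul_card_biUnion_add {ι β : Type*} [DecidableEq ι] [DecidableEq β]
    (s : Finset ι) (K : ι → Finset β) :
    2 * ∑ i ∈ s, (K i).card ≤ 2 * (s.biUnion K).card + ∑ i ∈ s, ∑ j ∈ s.erase i, (K i ∩ K j).card := by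
  induction s using Finset.induction_on with
  | empty => simp
  | insert x s hx ih =>
    rw [Finset.sum_insert hx, Finset.biUnion_insert, Finset.sum_insert hx, Finset.erase_insert hx]
    have hU : (K x ∪ s.biUnion K).card + (K x ∩ s.biUnion K).card = (K x).card + (s.biUnion K).card :=
      Finset.card_union_add_card_inter _ _
    have hI : (K x ∩ s.biUnion K).card ≤ ∑ i ∈ s, (K i ∩ K x).card := by
      have h1 : K x ∩ s.biUnion K = s.biUnion (fun i => K i ∩ K x) := by
        ext b
        simp only [Finset.mem_inter, Finset.mem_biUnion]
        constructor
        · rintro ⟨hb, i, hi, hbi⟩; exact ⟨i, hi, hbi, hb⟩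
        · rintro ⟨i, hi, hbi, hb⟩; exact ⟨hb, i, hi, hbi⟩
      rw [h1]
      exact Finset.card_biUnion_le
    have hsym : ∀ i ∈ s, (K x ∩ K i).card = (K i ∩ K x).card := fun i _ => by rw [Finset.inter_comm]
    have hinner : ∀ i ∈ s, ∑ j ∈ (insert x s).erase i, (K i ∩ K j).card =
        (K i ∩ K x).card + ∑ j ∈ s.erase i, (K i ∩ K j).card := by
      intro i hi
      have hxi : x ≠ i := fun h => hx (h ▸ hi)
      rw [Finset.erase_insert_of_ne hxi, Finset.sum_insert (by simp [hx])]
    rw [Finset.sum_congr rfl hinner, Finset.sum_add_distrib, Finset.sum_congr rfl hsym]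
    omega

/-- **Bonferroni with uniform sizes**: `m` sets of size `≥ a` with pairwise intersections of size `≤ o` have a union
of size `≥ m·a − C(m, 2)·o`, in the additive form `m·a ≤ |⋃| + C(m, 2)·o`. -/
theorem mul_le_card_biUnion_add_choose_two_mul {ι β : Type*} [DecidableEq ι] [DecidableEq β]
    (s : Finset ι) (K : ι → Finset β) (a o : ℕ) (ha : ∀ i ∈ s, a ≤ (K i).card)
    (ho : ∀ i ∈ s, ∀ j ∈ s, i ≠ j → (K i ∩ K j).card ≤ o) :
    s.card * a ≤ (s.biUnion K).card + s.card.choose 2 * o := by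
  have h := two_mul_sum_card_le_two_mul_card_biUnion_add s K
  have h1 : s.card * a ≤ ∑ i ∈ s, (K i).card := by
    calc s.card * a = ∑ _i ∈ s, a := by rw [Finset.sum_const, smul_eq_mul]
      _ ≤ ∑ i ∈ s, (K i).card := Finset.sum_le_sum ha
  have h2 : ∑ i ∈ s, ∑ j ∈ s.erase i, (K i ∩ K j).card ≤ s.card * (s.card - 1) * o := by
    calc ∑ i ∈ s, ∑ j ∈ s.erase i, (K i ∩ K j).card ≤ ∑ i ∈ s, ∑ _j ∈ s.erase i, o := by
          apply Finset.sum_le_sum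
          intro i hi
          apply Finset.sum_le_sum
          intro j hj
          exact ho i hi j (Finset.mem_of_mem_erase hj) (Finset.ne_of_mem_erase hj).symm
      _ = ∑ i ∈ s, (s.card - 1) * o := by
          apply Finset.sum_congr rfl
          intro i hi
          rw [Finset.sum_const, smul_eq_mul, Finset.card_erase_of_mem hi]
      _ = s.card * (s.card - 1) * o := by rw [Finset.sum_const, smul_eq_mul]; ring
  have h3 : s.card * (s.card - 1) = 2 * s.card.choose 2 := by
    rw [Nat.choose_two_right]
    exact (Nat.two_mul_div_two_of_even (Nat.even_mul_pred_self _)).symm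
  nlinarith [h, h1, h2, h3]

/-- The `(|X| + j)`-element subsets of `F` containing `X`, as a finset of sets: `X ∪ s` for the `j`-subsets `s` of
`F ∖ X`. -/
noncomputable def oversets {F : Set α} (hF : F.Finite) (X : Set α) (j : ℕ) : Finset (Set α) :=
  ((hF.sdiff (t := X)).toFinset.powersetCard j).image (fun s : Finset α => X ∪ (s : Set α))

/-- Membership in `oversets`: `Q = X ∪ s` with `s ⊆ F ∖ X`, `|s| = j`. -/
theorem mem_oversets {F : Set α} (hF : F.Finite) {X : Set α} (hX : X ⊆ F) (j : ℕ) (Q : Set α) :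
    Q ∈ oversets hF X j ↔ X ⊆ Q ∧ Q ⊆ F ∧ (Q \ X).ncard = j := by
  unfold oversets
  rw [Finset.mem_image]
  constructor
  · rintro ⟨s, hs, rfl⟩
    rw [Finset.mem_powersetCard] at hs
    have hsF : (s : Set α) ⊆ F \ X := by
      intro x hx
      have := hs.1 (Finset.mem_coe.1 hx)
      rwa [Set.Finite.mem_toFinset] at this
    refine ⟨Set.subset_union_left, ?_, ?_⟩
    · exact Set.union_subset hX (hsF.trans Set.sdiff_subset)
    · have hdisj : Disjoint (s : Set α) X := by
        rw [Set.disjoint_left]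
        intro x hxs hxX
        exact (hsF hxs).2 hxX
      rw [Set.union_sdiff_left, hdisj.sdiff_eq_left, Set.ncard_coe_finset]
      exact hs.2
  · rintro ⟨hXQ, hQF, hQj⟩
    have hQfin : (Q \ X).Finite := (hF.subset hQF).subset Set.sdiff_subset
    refine ⟨hQfin.toFinset, ?_, ?_⟩
    · rw [Finset.mem_powersetCard]
      refine ⟨?_, by rw [← Set.ncard_eq_toFinset_card _ hQfin]; exact hQj⟩
      intro x hx
      rw [Set.Finite.mem_toFinset] at hx
      rw [Set.Finite.mem_toFinset]
      exact ⟨hQF hx.1, hx.2⟩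
    · simp only [Set.Finite.coe_toFinset]
      rw [Set.union_sdiff_cancel hXQ]

/-- The number of members of `oversets hF X j` is `C(|F| − |X|, j)` (for `X ⊆ F`). -/
theorem card_oversets {F : Set α} (hF : F.Finite) {X : Set α} (hX : X ⊆ F) (j : ℕ) :
    (oversets hF X j).card = (F.ncard - X.ncard).choose j := by
  unfold oversets
  rw [Finset.card_image_of_injOn, Finset.card_powersetCard, ← Set.ncard_eq_toFinset_card _ (hF.sdiff (t := X)),
    Set.ncard_sdiff hX (hF.subset hX)]
  intro s hs t ht hst
  have hs' := (Finset.mem_powersetCard.1 (Finset.mem_coe.1 hs)).1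
  have ht' := (Finset.mem_powersetCard.1 (Finset.mem_coe.1 ht)).1
  have key : ∀ u : Finset α, u ⊆ (hF.sdiff (t := X)).toFinset → (X ∪ (u : Set α)) \ X = (u : Set α) := by
    intro u hu
    rw [Set.union_sdiff_left]
    apply Disjoint.sdiff_eq_left
    rw [Set.disjoint_left]
    intro x hxu hxX
    have := hu (Finset.mem_coe.1 hxu)
    rw [Set.Finite.mem_toFinset] at this
    exact this.2 hxX
  have h : (s : Set α) = (t : Set α) := by
    rw [← key s hs', ← key t ht']
    simp only at hst
    rw [hst]
  exact Finset.coe_injective h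

/-- A member of `oversets hF X j` has exactly `|X| + j` elements. -/
theorem ncard_of_mem_oversets {F : Set α} (hF : F.Finite) {X : Set α} (hX : X ⊆ F) (j : ℕ) {Q : Set α}
    (hQ : Q ∈ oversets hF X j) : Q.ncard = X.ncard + j := by
  rw [mem_oversets hF hX] at hQ
  obtain ⟨hXQ, hQF, hj⟩ := hQ
  rw [← hj, add_comm, Set.ncard_sdiff_add_ncard_of_subset hXQ (hF.subset hQF)]

/-- **Two distinct triangles meet in at most one point** under (C1) (`inter_eq_singleton_of_mem_trianglesThrough`). -/
theorem ncard_inter_le_one_of_triangles (M : Matroid α) [M.Finite]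
    (hC1 : ∀ L ⊆ M.E, M.eRk L = 2 → L.ncard ≤ 3) {C C' : Set α}
    (hC : M.IsCircuit C ∧ C.ncard = 3) (hC' : M.IsCircuit C' ∧ C'.ncard = 3) (hne : C ≠ C') :
    (C ∩ C').ncard ≤ 1 := by
  by_cases h : C ∩ C' = ∅
  · rw [h, Set.ncard_empty]; exact zero_le_one
  · obtain ⟨x, hx⟩ := Set.nonempty_iff_ne_empty.2 h
    have hT : C ∈ ThmN.trianglesThrough M x := ⟨hC.1, hC.2, hx.1⟩
    have hT' : C' ∈ ThmN.trianglesThrough M x := ⟨hC'.1, hC'.2, hx.2⟩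
    rw [ThmN.inter_eq_singleton_of_mem_trianglesThrough M hC1 hT hT' hne, Set.ncard_singleton]

/-- Two distinct triangles cover at least five points (C1). -/
theorem five_le_ncard_union_of_triangles (M : Matroid α) [M.Finite]
    (hC1 : ∀ L ⊆ M.E, M.eRk L = 2 → L.ncard ≤ 3) {C C' : Set α}
    (hC : M.IsCircuit C ∧ C.ncard = 3) (hC' : M.IsCircuit C' ∧ C'.ncard = 3) (hne : C ≠ C') :
    5 ≤ (C ∪ C').ncard := by
  have hfin : C.Finite := M.ground_finite.subset hC.1.subset_ground
  have hfin' : C'.Finite := M.ground_finite.subset hC'.1.subset_ground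
  have h := Set.ncard_union_add_ncard_inter C C' hfin hfin'
  have h1 := ncard_inter_le_one_of_triangles M hC1 hC hC' hne
  omega

/-- A `p`-subset of `E` through a circuit is dependent, so its rank is `< p`. -/
theorem eRk_lt_of_circuit_subset (M : Matroid α) [M.Finite] {C A : Set α} (hC : M.IsCircuit C)
    (hCA : C ⊆ A) (hA : A ⊆ M.E) {p : ℕ} (hAp : A.ncard = p) : M.eRk A < (p : ℕ∞) := by
  have hAfin : A.Finite := M.ground_finite.subset hA
  have hdep : M.Dep A := hC.dep.superset hCA hA
  have h := M.eRk_lt_encard_of_dep_of_finite hAfin hdep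
  rwa [← hAfin.cast_ncard_eq, hAp] at h

/-- **THE KILL LEVER — THE `Y`-SIDE WITH THE DEPENDENT `p`-SETS** (SUBCLAIM-S1 §6.6). For `m` distinct circuits
`𝒯` of size `k ≤ p` of a core with (C1)–(C3), pairwise covering `≥ 5` points:
`7560·(Σ_{j=5}^{p−1} C(n, j) + m·C(n − k, p − k)) ≤ 7560·#Y(p, 4) + R₃ + R₄ + 7560·C(m, 2)·C(n − 5, p − 5)` —
the `p`-sets through a circuit are dependent, hence `Y`-sets unless of rank `≤ 4` (then in `R₃ + R₄`), and the
`p`-supersets of two of the circuits overlap in `≤ C(n − 5, p − 5)` sets (Bonferroni). -/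
theorem midCount_ge_K7_kill (M : Matroid α) [M.Finite]
    (hcirc : ∀ C, M.IsCircuit C → 3 ≤ C.encard)
    (hline : ∀ L ⊆ M.E, M.eRk L ≤ 2 → L.ncard ≤ 3) (hplane : ∀ P ⊆ M.E, M.eRk P ≤ 3 → P.ncard ≤ 6)
    (hten : ∀ X ⊆ M.E, M.eRk X ≤ 4 → X.ncard ≤ 10) {d : ℕ} (hd : M.E.encard = M.eRank + d) (p : ℕ) (hp : 5 ≤ p)
    (k : ℕ) (hkp : k ≤ p) (𝒯 : Finset (Set α)) (h𝒯 : ∀ C ∈ 𝒯, M.IsCircuit C ∧ C.ncard = k)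
    (hpair : ∀ C ∈ 𝒯, ∀ C' ∈ 𝒯, C ≠ C' → 5 ≤ (C ∪ C').ncard) :
    7560 * (∑ j ∈ Finset.Ico 5 p, M.E.ncard.choose j + 𝒯.card * (M.E.ncard - k).choose (p - k)) ≤
      7560 * Matroid.midCount M p 4 +
      10584 * ({C : Set α | M.IsCircuit C ∧ C.ncard = 3}.ncard * (M.E.ncard - 3) +
        {C : Set α | M.IsCircuit C ∧ C.ncard = 4}.ncard) +
      (RSK 10 * ({C : Set α | M.IsCircuit C ∧ C.ncard = 3}.ncard * (M.E.ncard - 3).choose 2 +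
        {C : Set α | M.IsCircuit C ∧ C.ncard = 4}.ncard * (M.E.ncard - 4) +
        {C : Set α | M.IsCircuit C ∧ C.ncard = 5}.ncard) +
      (RBK 10 - RSK 10) * ({C : Set α | M.IsCircuit C ∧ C.ncard = 3}.ncard * (min (5 * d) M.E.ncard - 3).choose 2 +
        {C : Set α | M.IsCircuit C ∧ C.ncard = 4}.ncard * (min (5 * d) M.E.ncard - 4) +
        {C : Set α | M.IsCircuit C ∧ C.ncard = 5}.ncard)) +
      7560 * (𝒯.card.choose 2 * (M.E.ncard - 5).choose (p - 5)) := by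
  classical
  have hY3 := five_mul_ncard_rankLe3_ge_five_le M hcirc hline hplane
  have hY2 := ncard_rankEq4_ge_five_le_K M hcirc hline hplane hten hd
  have hEfin : M.E.Finite := M.ground_finite
  set Ef := hEfin.toFinset with hEf
  -- the sets with `5 ≤ |A| ≤ p − 1`
  set 𝓑 : ℕ → Finset (Set α) := fun j => (Ef.powersetCard j).image (fun s : Finset α => (s : Set α)) with h𝓑
  have h𝓑card : ∀ j, (𝓑 j).card = M.E.ncard.choose j := fun j => by
    rw [h𝓑]; exact card_image_powersetCard hEfin j
  have hmem𝓑 : ∀ j A, A ∈ 𝓑 j ↔ A ⊆ M.E ∧ A.ncard = j := fun j A =>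
    mem_image_powersetCard_iff hEfin j A
  have hdisj : ((Finset.Ico 5 p : Finset ℕ) : Set ℕ).PairwiseDisjoint 𝓑 := by
    intro i _ j _ hij
    rw [Function.onFun, Finset.disjoint_left]
    intro A hA hA'
    rw [hmem𝓑] at hA hA'
    exact hij (hA.2.symm.trans hA'.2)
  set W := (Finset.Ico 5 p).biUnion 𝓑 with hW
  have hWcard : W.card = ∑ j ∈ Finset.Ico 5 p, M.E.ncard.choose j := by
    rw [hW, Finset.card_biUnion hdisj]
    exact Finset.sum_congr rfl (fun j _ => h𝓑card j)
  have hmemW : ∀ A ∈ W, A ⊆ M.E ∧ 5 ≤ A.ncard ∧ A.ncard < p := by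
    intro A hA
    rw [hW, Finset.mem_biUnion] at hA
    obtain ⟨j, hj, hAj⟩ := hA
    rw [Finset.mem_Ico] at hj
    rw [hmem𝓑] at hAj
    exact ⟨hAj.1, by omega, by omega⟩
  -- the kill: the `p`-sets through the triangles of `𝒯`
  set Kf : Set α → Finset (Set α) := fun C => oversets hEfin C (p - k) with hKf
  set KK := 𝒯.biUnion Kf with hKK
  have hmemK : ∀ A ∈ KK, A ⊆ M.E ∧ A.ncard = p ∧ ∃ C ∈ 𝒯, C ⊆ A := by
    intro A hA
    rw [hKK, Finset.mem_biUnion] at hA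
    obtain ⟨C, hC, hAC⟩ := hA
    have hCE : C ⊆ M.E := (h𝒯 C hC).1.subset_ground
    have hcard := ncard_of_mem_oversets hEfin hCE (p - k) hAC
    rw [hKf] at hAC
    rw [mem_oversets hEfin hCE] at hAC
    refine ⟨hAC.2.1, ?_, C, hC, hAC.1⟩
    rw [hcard, (h𝒯 C hC).2]
    omega
  have hKcard : 𝒯.card * (M.E.ncard - k).choose (p - k) ≤
      KK.card + 𝒯.card.choose 2 * (M.E.ncard - 5).choose (p - 5) := by
    refine mul_le_card_biUnion_add_choose_two_mul 𝒯 Kf _ _ ?_ ?_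
    · intro C hC
      have hCE : C ⊆ M.E := (h𝒯 C hC).1.subset_ground
      rw [hKf]
      simp only
      rw [card_oversets hEfin hCE, (h𝒯 C hC).2]
    · intro C hC C' hC' hne
      have hCE : C ⊆ M.E := (h𝒯 C hC).1.subset_ground
      have hC'E : C' ⊆ M.E := (h𝒯 C' hC').1.subset_ground
      have h5 := hpair C hC C' hC' hne
      obtain ⟨X, hXsub, hX5⟩ := Set.exists_subset_card_eq h5
      have hXE : X ⊆ M.E := hXsub.trans (Set.union_subset hCE hC'E)
      have hsub : Kf C ∩ Kf C' ⊆ oversets hEfin X (p - 5) := by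
        intro Q hQ
        rw [Finset.mem_inter] at hQ
        have hQ1 := hQ.1
        have hQcard := ncard_of_mem_oversets hEfin hCE (p - k) hQ.1
        rw [hKf] at hQ
        simp only at hQ
        rw [mem_oversets hEfin hCE] at hQ
        have hQ2 := hQ.2
        rw [mem_oversets hEfin hC'E] at hQ2
        rw [mem_oversets hEfin hXE]
        refine ⟨hXsub.trans (Set.union_subset hQ.1.1 hQ2.1), hQ.1.2.1, ?_⟩
        have hQfin : Q.Finite := hEfin.subset hQ.1.2.1
        have hXQ : X ⊆ Q := hXsub.trans (Set.union_subset hQ.1.1 hQ2.1)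
        rw [Set.ncard_sdiff hXQ (hQfin.subset hXQ), hQcard, (h𝒯 C hC).2, hX5]
        omega
      calc (Kf C ∩ Kf C').card ≤ (oversets hEfin X (p - 5)).card := Finset.card_le_card hsub
        _ = (M.E.ncard - 5).choose (p - 5) := by rw [card_oversets hEfin hXE, hX5]
  -- `W ∪ KK ⊆ Y ∪ T₃ ∪ T₄`, and `W`, `KK` are disjoint (sizes `< p` versus `= p`)
  set Y := {A : Set α | A ⊆ M.E ∧ (4 : ℕ∞) < M.eRk A ∧ M.eRk A < (p : ℕ∞)} with hY
  set T₃ := {A : Set α | A ⊆ M.E ∧ M.eRk A ≤ 3 ∧ 5 ≤ A.ncard} with hT₃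
  set T₄ := {A : Set α | A ⊆ M.E ∧ M.eRk A = 4 ∧ 5 ≤ A.ncard} with hT₄
  have hclass : ∀ A, A ⊆ M.E → 5 ≤ A.ncard → M.eRk A < (p : ℕ∞) → A ∈ Y ∪ T₃ ∪ T₄ := by
    intro A hAE h5 hlt
    by_cases h4 : (4 : ℕ∞) < M.eRk A
    · exact Or.inl (Or.inl ⟨hAE, h4, hlt⟩)
    · push Not at h4
      rcases h4.lt_or_eq with h | h
      · have h3 : M.eRk A ≤ 3 := by
          have : M.eRk A < (3 : ℕ∞) + 1 := by rw [show ((3 : ℕ∞) + 1) = 4 by norm_num]; exact h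
          simpa using Order.le_of_lt_add_one this
        exact Or.inl (Or.inr ⟨hAE, h3, h5⟩)
      · exact Or.inr ⟨hAE, h, h5⟩
  have hsub : ((W ∪ KK : Finset (Set α)) : Set (Set α)) ⊆ Y ∪ T₃ ∪ T₄ := by
    intro A hA
    rw [Finset.mem_coe, Finset.mem_union] at hA
    rcases hA with hA | hA
    · obtain ⟨hAE, h5, hlt⟩ := hmemW A hA
      have hAfin : A.Finite := hEfin.subset hAE
      refine hclass A hAE h5 ?_
      calc M.eRk A ≤ A.encard := M.eRk_le_encard A
        _ = (A.ncard : ℕ∞) := hAfin.cast_ncard_eq.symm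
        _ < (p : ℕ∞) := by exact_mod_cast hlt
    · obtain ⟨hAE, hAp, C, hC, hCA⟩ := hmemK A hA
      exact hclass A hAE (by omega) (eRk_lt_of_circuit_subset M (h𝒯 C hC).1 hCA hAE hAp)
  have hWK : Disjoint W KK := by
    rw [Finset.disjoint_left]
    intro A hAW hAK
    have h1 := (hmemW A hAW).2.2
    have h2 := (hmemK A hAK).2.1
    omega
  have hYfin : Y.Finite := hEfin.finite_subsets.subset (fun A hA => hA.1)
  have hT₃fin : T₃.Finite := hEfin.finite_subsets.subset (fun A hA => hA.1)
  have hT₄fin : T₄.Finite := hEfin.finite_subsets.subset (fun A hA => hA.1)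
  have hWle : W.card + KK.card ≤ Y.ncard + T₃.ncard + T₄.ncard := by
    calc W.card + KK.card = (W ∪ KK).card := (Finset.card_union_of_disjoint hWK).symm
      _ = ((W ∪ KK : Finset (Set α)) : Set (Set α)).ncard := (Set.ncard_coe_finset _).symm
      _ ≤ (Y ∪ T₃ ∪ T₄).ncard := Set.ncard_le_ncard hsub ((hYfin.union hT₃fin).union hT₄fin)
      _ ≤ (Y ∪ T₃).ncard + T₄.ncard := Set.ncard_union_le _ _
      _ ≤ Y.ncard + T₃.ncard + T₄.ncard := by
          have := Set.ncard_union_le Y T₃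
          omega
  have hmid : Matroid.midCount M p 4 = Y.ncard := rfl
  rw [← hWcard, hmid]
  have hY3' : 5 * T₃.ncard ≤ 7 * ({C : Set α | M.IsCircuit C ∧ C.ncard = 3}.ncard * (M.E.ncard - 3) +
      {C : Set α | M.IsCircuit C ∧ C.ncard = 4}.ncard) := hY3
  have hY2' : 7560 * T₄.ncard ≤ _ := hY2
  nlinarith [hWle, hY3', hY2', hKcard]

/-- **The kill of `m` triangles**: two distinct triangles cover `≥ 5` points under (C1). -/
theorem midCount_ge_K7_kill_triangles (M : Matroid α) [M.Finite]
    (hcirc : ∀ C, M.IsCircuit C → 3 ≤ C.encard)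
    (hline : ∀ L ⊆ M.E, M.eRk L ≤ 2 → L.ncard ≤ 3) (hplane : ∀ P ⊆ M.E, M.eRk P ≤ 3 → P.ncard ≤ 6)
    (hten : ∀ X ⊆ M.E, M.eRk X ≤ 4 → X.ncard ≤ 10) {d : ℕ} (hd : M.E.encard = M.eRank + d) (p : ℕ) (hp : 5 ≤ p)
    (𝒯 : Finset (Set α)) (h𝒯 : ∀ C ∈ 𝒯, M.IsCircuit C ∧ C.ncard = 3) :
    7560 * (∑ j ∈ Finset.Ico 5 p, M.E.ncard.choose j + 𝒯.card * (M.E.ncard - 3).choose (p - 3)) ≤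
      7560 * Matroid.midCount M p 4 +
      10584 * ({C : Set α | M.IsCircuit C ∧ C.ncard = 3}.ncard * (M.E.ncard - 3) +
        {C : Set α | M.IsCircuit C ∧ C.ncard = 4}.ncard) +
      (RSK 10 * ({C : Set α | M.IsCircuit C ∧ C.ncard = 3}.ncard * (M.E.ncard - 3).choose 2 +
        {C : Set α | M.IsCircuit C ∧ C.ncard = 4}.ncard * (M.E.ncard - 4) +
        {C : Set α | M.IsCircuit C ∧ C.ncard = 5}.ncard) +
      (RBK 10 - RSK 10) * ({C : Set α | M.IsCircuit C ∧ C.ncard = 3}.ncard * (min (5 * d) M.E.ncard - 3).choose 2 +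
        {C : Set α | M.IsCircuit C ∧ C.ncard = 4}.ncard * (min (5 * d) M.E.ncard - 4) +
        {C : Set α | M.IsCircuit C ∧ C.ncard = 5}.ncard)) +
      7560 * (𝒯.card.choose 2 * (M.E.ncard - 5).choose (p - 5)) :=
  midCount_ge_K7_kill M hcirc hline hplane hten hd p hp 3 (by omega) 𝒯 h𝒯
    (fun C hC C' hC' hne => five_le_ncard_union_of_triangles M (fun L hL hr => hline L hL hr.le)
      (h𝒯 C hC) (h𝒯 C' hC') hne)

/-- Two distinct circuits of size `4` cover `≥ 5` points (neither contains the other). -/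
theorem five_le_ncard_union_of_four_circuits (M : Matroid α) [M.Finite] {C C' : Set α}
    (hC : M.IsCircuit C ∧ C.ncard = 4) (hC' : M.IsCircuit C' ∧ C'.ncard = 4) (hne : C ≠ C') :
    5 ≤ (C ∪ C').ncard := by
  have hfin : C.Finite := M.ground_finite.subset hC.1.subset_ground
  have hfin' : C'.Finite := M.ground_finite.subset hC'.1.subset_ground
  have hss : C ⊂ C ∪ C' := by
    refine ⟨Set.subset_union_left, fun h => hne ?_⟩
    have hC'C : C' ⊆ C := Set.subset_union_right.trans h
    exact (hC'.1.eq_of_subset_isCircuit hC.1 hC'C).symm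
  have h := Set.ncard_lt_ncard hss (hfin.union hfin')
  omega

/-- **The kill of `m` four-circuits**. -/
theorem midCount_ge_K7_kill_four (M : Matroid α) [M.Finite]
    (hcirc : ∀ C, M.IsCircuit C → 3 ≤ C.encard)
    (hline : ∀ L ⊆ M.E, M.eRk L ≤ 2 → L.ncard ≤ 3) (hplane : ∀ P ⊆ M.E, M.eRk P ≤ 3 → P.ncard ≤ 6)
    (hten : ∀ X ⊆ M.E, M.eRk X ≤ 4 → X.ncard ≤ 10) {d : ℕ} (hd : M.E.encard = M.eRank + d) (p : ℕ) (hp : 5 ≤ p)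
    (𝒯 : Finset (Set α)) (h𝒯 : ∀ C ∈ 𝒯, M.IsCircuit C ∧ C.ncard = 4) :
    7560 * (∑ j ∈ Finset.Ico 5 p, M.E.ncard.choose j + 𝒯.card * (M.E.ncard - 4).choose (p - 4)) ≤
      7560 * Matroid.midCount M p 4 +
      10584 * ({C : Set α | M.IsCircuit C ∧ C.ncard = 3}.ncard * (M.E.ncard - 3) +
        {C : Set α | M.IsCircuit C ∧ C.ncard = 4}.ncard) +
      (RSK 10 * ({C : Set α | M.IsCircuit C ∧ C.ncard = 3}.ncard * (M.E.ncard - 3).choose 2 +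
        {C : Set α | M.IsCircuit C ∧ C.ncard = 4}.ncard * (M.E.ncard - 4) +
        {C : Set α | M.IsCircuit C ∧ C.ncard = 5}.ncard) +
      (RBK 10 - RSK 10) * ({C : Set α | M.IsCircuit C ∧ C.ncard = 3}.ncard * (min (5 * d) M.E.ncard - 3).choose 2 +
        {C : Set α | M.IsCircuit C ∧ C.ncard = 4}.ncard * (min (5 * d) M.E.ncard - 4) +
        {C : Set α | M.IsCircuit C ∧ C.ncard = 5}.ncard)) +
      7560 * (𝒯.card.choose 2 * (M.E.ncard - 5).choose (p - 5)) :=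
  midCount_ge_K7_kill M hcirc hline hplane hten hd p hp 4 (by omega) 𝒯 h𝒯
    (fun C hC C' hC' hne => five_le_ncard_union_of_four_circuits M (h𝒯 C hC) (h𝒯 C' hC') hne)

end S1

end PercRepro
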